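import Summits.Ventures.HSemireg.WedgeHankelRecurrenceGaussDefect
import Summits.Ventures.HSemireg.WedgeHankelRecurrenceGaussNodesExtreme

/-!
# Venture HSemireg — **THE SHIFTED RULE: the nodes of the `(t+1)`-point Gauss rule of `(x − c)·σ` INTERLACE with the nodes of the `(t+2)`-point Gauss rule of `σ`** (`c` below all
# nodes; mirror statement for `c` above all nodes with `(c − x)·σ`): if `Σ_l ν_l w_l^p = Σ_j μ_j (v_j − c) v_j^p` for `p ≤ 2t + 1` with `μ_j > 0`, `c < v_j`, `v`, `w` strictly
# increasing, then `v_0 < w_0 < v_1 < w_1 < ⋯ < w_t < v_{t+1}` — the zeros of the kernel (Christoffel) polynomial of degree `t + 1` with parameter `c` separate the zeros of `p_{t+2}`;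
# a COROLLARY of N262 (the weights `μ_j (v_j − c)` are positive), with the measure-level version in which the positivity of the Gauss weights and `c < v_0` are themselves derived
# (N265 `gauss_weight_pos`, N264 `exists_node_le_gaussNode_zero`)

HONEST FRAMING. Part of the Lean index of the computation cell `pub-hsemireg` (seat p10 gen 42, Sunday typer «UNIFORM-IN-n»).  Finite sums only, on top of N262 ∕ N264 ∕ N265; no
variety, no cohomology theory, no sheaf, no Ext group and no semiregularity map is constructed here; nothing here says that HC / HC_CM / HC_AV holds; no Literature fact (unproved
`Prop`) is declared or used.  Custodian versions as in `WedgeHankelSiegelIdeal` (1/3).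
SOURCES (cited).  G. Szegő, *Orthogonal Polynomials*, AMS Colloq. Publ. 23, Thm 2.5 (Christoffel's formula: the orthogonal polynomials of `(x − c) dα` are
`[p_{n+1}(x) p_n(c) − p_n(x) p_{n+1}(c)]/(x − c)` up to a constant) with Thm 3.3.2; T. S. Chihara, *An Introduction to Orthogonal Polynomials* (1978), Ch. I §7 (kernel polynomials;
Thm 7.2: for `c` to the left of the true interval of orthogonality the zeros of the kernel polynomial `K_n(c; x)` separate those of `P_{n+1}`); M. G. Krein, A. A. Nudel'man, *The Markov
Moment Problem and Extremal Problems* (1977), Ch. III (canonical representations of `(s_p)` and of the shifted sequence `(s_{p+1} − c s_p)`).  This lineage's OPEN item (c) of gen 41.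
PROOF TYPED HERE.  The data say that `(ν, w)` (`t + 1` atoms) and `(μ_j (v_j − c), v_j)` (`t + 2` atoms, POSITIVE weights) represent the same `s′_0, …, s′_{2t+1}`; N262
`gauss_nodes_interlace` is exactly this situation.  For the measure-level version the identity `Σ M (V − c) V^p = Σ μ v^{p+1} − c Σ μ v^p` transfers the big moments, N265 gives `μ_j > 0`
and N264 gives a big node `≤ v_0`, whence `c < v_0`.
DEDUP DISCLOSURE (`rg -n 'shift|kernel polynomial|Christoffel' Summits/Ventures/HSemireg/WedgeHankelRecurrenceGauss*`, 2026-09-02): N262 treats consecutive rules of ONE sequence; nothing on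
the shifted sequence.  The 5 names below: 0 hits tree-wide.

WHAT IS IN THE TREE.  N262 `gauss_nodes_interlace`; N264 `exists_node_le_gaussNode_zero`, `exists_gaussNode_last_le_node`; N265 `gauss_weight_pos`.
THIS FILE (namespace `Summit.Ventures.HSemireg.Wedge.HankelOuter` continued; CHAINED on N266 (import only) and N264; 0 definitions):
* §1032 **`gauss_nodes_shift_interlace`** (`c` below: `v_k < w_k < v_{k+1}`), `gauss_nodes_shift_interlace_above` (`c` above all nodes, weights `μ_j (c − v_j)`: the same interlacing),
  `gauss_nodes_interlace_stieltjes` (`c = 0`, positive nodes: the rules of `(s_p)` and of `(s_{p+1})` — Gantmacher's two Hankel forms), `sum_mul_sub_mul_pow_eq_of_moments` (moment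
  transfer `Σ M (V − c) V^p = Σ μ (v − c) v^p`), **`gauss_nodes_shift_interlace_of_moments`** (MEASURE-LEVEL: both rules Gauss for a positive `(M, V)` with `≥ t + 3` distinct nodes all
  `> c` ⇒ interlacing, the positivity of the Gauss weights and `c < v_0` being DERIVED).
CAVEATS.  Discrete integrating representation only; nothing Ext-side.  New names only.
-/

open Module Polynomial
open scoped Matrix Polynomial

namespace Summit.Ventures.HSemireg.Wedge.HankelOuter

/-! ## §1032. The shifted rule -/

/-- **THE SHIFTED RULE INTERLACES** (`c` below all nodes): if `Σ_l ν_l w_l^p = Σ_j μ_j (v_j − c) v_j^p` for `p ≤ 2t + 1` with `μ_j > 0`, `c < v_j`, `v : Fin (t+2) → ℝ` and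
`w : Fin (t+1) → ℝ` strictly increasing, then `v_k < w_k < v_{k+1}` for every `k ≤ t`. [Chihara I §7 Thm 7.2; Szegő Thm 2.5 + Thm 3.3.2; this file, §1032] -/
theorem gauss_nodes_shift_interlace {t : ℕ} {μ v : Fin (t + 2) → ℝ} {ν w : Fin (t + 1) → ℝ} {c : ℝ} (hμ : ∀ j, 0 < μ j) (hv : StrictMono v) (hcv : ∀ j, c < v j)
    (hw : StrictMono w) (hmom : ∀ p, p ≤ 2 * t + 1 → ∑ l, ν l * w l ^ p = ∑ j, (μ j * (v j - c)) * v j ^ p) (k : Fin (t + 1)) :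
    v k.castSucc < w k ∧ w k < v k.succ :=
  gauss_nodes_interlace (ν := fun j => μ j * (v j - c)) hw (fun j => mul_pos (hμ j) (sub_pos.2 (hcv j))) hv hmom k

/-- **The shifted rule interlaces** (`c` above all nodes, density `c − x`): if `Σ_l ν_l w_l^p = Σ_j μ_j (c − v_j) v_j^p` for `p ≤ 2t + 1` with `μ_j > 0`, `v_j < c`, then again
`v_k < w_k < v_{k+1}`. [Chihara I §7; this file, §1032] -/
theorem gauss_nodes_shift_interlace_above {t : ℕ} {μ v : Fin (t + 2) → ℝ} {ν w : Fin (t + 1) → ℝ} {c : ℝ} (hμ : ∀ j, 0 < μ j) (hv : StrictMono v) (hvc : ∀ j, v j < c)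
    (hw : StrictMono w) (hmom : ∀ p, p ≤ 2 * t + 1 → ∑ l, ν l * w l ^ p = ∑ j, (μ j * (c - v j)) * v j ^ p) (k : Fin (t + 1)) :
    v k.castSucc < w k ∧ w k < v k.succ :=
  gauss_nodes_interlace (ν := fun j => μ j * (c - v j)) hw (fun j => mul_pos (hμ j) (sub_pos.2 (hvc j))) hv hmom k

/-- **The Stieltjes case `c = 0`** (Gantmacher's two Hankel forms `(s_{i+k})` and `(s_{i+k+1})`): if `Σ_l ν_l w_l^p = Σ_j μ_j v_j^{p+1}` for `p ≤ 2t + 1` with `μ_j > 0`, `v_j > 0`,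
then the `t + 1` nodes `w` of the shifted sequence separate the `t + 2` nodes `v`. [Gantmacher XV §16; Krein–Nudel'man III; this file, §1032] -/
theorem gauss_nodes_interlace_stieltjes {t : ℕ} {μ v : Fin (t + 2) → ℝ} {ν w : Fin (t + 1) → ℝ} (hμ : ∀ j, 0 < μ j) (hv : StrictMono v) (hv0 : ∀ j, 0 < v j)
    (hw : StrictMono w) (hmom : ∀ p, p ≤ 2 * t + 1 → ∑ l, ν l * w l ^ p = ∑ j, μ j * v j ^ (p + 1)) (k : Fin (t + 1)) :
    v k.castSucc < w k ∧ w k < v k.succ := by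
  refine gauss_nodes_shift_interlace (ν := ν) (c := 0) hμ hv hv0 hw (fun p hp => ?_) k
  rw [hmom p hp]
  exact Finset.sum_congr rfl fun j _ => by rw [sub_zero, pow_succ]; ring

/-- **Moment transfer**: if `(μ, v)` represents `(M, V)` up to degree `N + 1` then `Σ_l M_l (V_l − c) V_l^p = Σ_j μ_j (v_j − c) v_j^p` for `p ≤ N`. [bookkeeping; this file, §1032] -/
theorem sum_mul_sub_mul_pow_eq_of_moments {m P N : ℕ} {μ v : Fin m → ℝ} {M V : Fin P → ℝ} {c : ℝ} (hA : ∀ p, p ≤ N + 1 → ∑ j, μ j * v j ^ p = ∑ l, M l * V l ^ p)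
    {p : ℕ} (hp : p ≤ N) : ∑ l, (M l * (V l - c)) * V l ^ p = ∑ j, (μ j * (v j - c)) * v j ^ p := by
  have h1 := hA (p + 1) (by omega)
  have h0 := hA p (by omega)
  have hl : ∑ l, (M l * (V l - c)) * V l ^ p = ∑ l, M l * V l ^ (p + 1) - c * ∑ l, M l * V l ^ p := by
    rw [Finset.mul_sum, ← Finset.sum_sub_distrib]
    exact Finset.sum_congr rfl fun l _ => by rw [pow_succ]; ring
  have hr : ∑ j, (μ j * (v j - c)) * v j ^ p = ∑ j, μ j * v j ^ (p + 1) - c * ∑ j, μ j * v j ^ p := by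
    rw [Finset.mul_sum, ← Finset.sum_sub_distrib]
    exact Finset.sum_congr rfl fun j _ => by rw [pow_succ]; ring
  rw [hl, hr, h1, h0]

/-- **THE SHIFTED RULE INTERLACES — measure-level statement.**  Let `(M, V)` be a positive discrete measure with at least `t + 3` distinct nodes, all `> c`; let `(μ, v)` be its
`(t+2)`-point Gauss rule (`Σ_j μ_j v_j^p = Σ_l M_l V_l^p` for `p ≤ 2t + 3`) and `(ν, w)` the `(t+1)`-point Gauss rule of `(x − c)·(M, V)` (`Σ_l ν_l w_l^p = Σ_l M_l (V_l − c) V_l^p` for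
`p ≤ 2t + 1`), both with strictly increasing nodes.  Then `v_k < w_k < v_{k+1}` for all `k ≤ t`; the positivity of the `μ_j` (N265) and `c < v_0` (N264) are consequences, not hypotheses.
[Chihara I §7 Thm 7.2; Szegő Thm 2.5; this file, §1032] -/
theorem gauss_nodes_shift_interlace_of_moments {t P : ℕ} {μ v : Fin (t + 2) → ℝ} {ν w : Fin (t + 1) → ℝ} {M V : Fin P → ℝ} {c : ℝ} (hM : ∀ l, 0 < M l) (hV : Function.Injective V)
    (hP : t + 3 ≤ P) (hcV : ∀ l, c < V l) (hv : StrictMono v) (hw : StrictMono w) (hA : ∀ p, p ≤ 2 * t + 3 → ∑ j, μ j * v j ^ p = ∑ l, M l * V l ^ p)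
    (hB : ∀ p, p ≤ 2 * t + 1 → ∑ l, ν l * w l ^ p = ∑ l, (M l * (V l - c)) * V l ^ p) (k : Fin (t + 1)) :
    v k.castSucc < w k ∧ w k < v k.succ := by
  -- the Gauss weights of `σ` are positive (Christoffel)
  have hμ : ∀ j, 0 < μ j := gauss_weight_pos (t := t + 1) hv.injective hM hV (by omega) (fun p hp => hA p (by omega))
  -- a big node lies below `v_0`, so `c < v_0 ≤ v_j`
  obtain ⟨l₀, hl₀⟩ := exists_node_le_gaussNode_zero (t := t + 1) hμ hv hM (fun p hp => hA p (by omega))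
  have hcv : ∀ j, c < v j := fun j => lt_of_lt_of_le (lt_of_lt_of_le (hcV l₀) hl₀) (hv.monotone (Fin.zero_le j))
  exact gauss_nodes_shift_interlace (ν := ν) hμ hv hcv hw (fun p hp => by rw [hB p hp]; exact sum_mul_sub_mul_pow_eq_of_moments (N := 2 * t + 2) hA (by omega)) k

end Summit.Ventures.HSemireg.Wedge.HankelOuter
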